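/-
Copyright (c) 2026 the pub-hodgecm-mathlib formalisation cell (harness21).  Prover seat hodgecm-mathlib-K2Liu-p11 (g0), Track B «K2-LIT»,
#184♮ = hLiu418 = `stmt-HodgeConjecture-24832`; LEAD F0P6-plan (g13) RULING M-157d (4) (compact-picture letters) + K2Liu-p05 (g4)
09:29:02Z ask: «`K_w` as a CLOSED `Subgroup (unitaryGroup (l ⊕ l) ℂ)` + the finite-dimensionality transport of right translates» (F2's binders).
DEFINITION `siegelStabSubgroup` + letters.
-/
import Summits.HodgeConjecture.HodgeConjecture.Theorems.K2LiuSiegelStabBlocks   -- ★ (this seat): `Stab(i1) = U(J) ∩ U(2l)` block-wise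
import HarnessLib

/-!
# Crux `HLiu418`, compact-picture letters: `K_w = U(J) ∩ U(2l)` as a closed subgroup of the unitary group, in F2's binders

Cell `hodgecm-mathlib`, crux item hLiu418 = `stmt-HodgeConjecture-24832` (helper lane `--supports`, count-neutral; definition lane).

★ p05 F2 `exists_mvPolynomial_of_finiteDimensional_span_rightTranslates` takes `(K : Subgroup (Matrix.unitaryGroup n ℂ)) (hK : IsClosed K)
(f : K → ℂ) (hf : Continuous f) (hfin : FiniteDimensional ℂ (span (range fun k₀ : K => fun k : K => f (k * k₀))))`.  This file supplies
`K := siegelStabSubgroup l` = the maximal compact `K_w = Stab_{U(J)}(i1) = U(J) ∩ U(2l)` of the tube frame in exactly that currency: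
* `siegelStabSubgroup l : Subgroup (Matrix.unitaryGroup (l ⊕ l) ℂ)`, carrier `{U | Uᴴ J U = J}` (`mem_siegelStabSubgroup_iff`);
* `isClosed_siegelStabSubgroup`; `moeb_I_of_mem` (its elements fix `i1`, ★ `moeb_I_eq_I_of_mem_unitaryGroup`);
  `exists_mem_coe_eq` (every `u ∈ U(J)` fixing `i1` is `(U : Matrix)` for a `U ∈ siegelStabSubgroup l`, ★ `mem_unitaryGroup_of_stab`);
* `finiteDimensional_span_rightTranslates_restrict` — THE TRANSPORT: if the right `K_w`-translates of `f : Matrix → ℂ` span a finite-dimensional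
  space, so do the right translates of its restriction `fun k : K => f k` (image under the restriction linear map).
References: [Shimura1997, §6.5] (derived).
HONEST LABEL: HC_CM is proved only modulo the 7 printed citations (2 remaining named inputs: hLiu418 = stmt-HodgeConjecture-24832,
h413 = stmt-HodgeConjecture-24833) until rung 0 closes; count-neutral helper, closes no socket.
-/

set_option autoImplicit false
set_option linter.dupNamespace false

noncomputable section

open Complex Matrix
open scoped ComplexOrder ComplexConjugate

namespace Summit.HodgeConjecture.HodgeConjecture.Cruxes.HLiu418.K2LiuSiegelStabSubgroup

open Literature.NumberTheory.ModularForms.SiegelUpperHalfSpace (moeb)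
open Summit.HodgeConjecture.HodgeConjecture.Cruxes.HLiu418.K2LiuHermitianTubeCocycle
open Summit.HodgeConjecture.HodgeConjecture.Cruxes.HLiu418.K2LiuSiegelStabBlocks

variable (l : Type*) [Fintype l] [DecidableEq l]

/-- **`K_w = U(J) ∩ U(2l)`** as a subgroup of the unitary group `unitaryGroup (l ⊕ l) ℂ`: the unitary matrices preserving the skew form `J`.
By ★ `moeb_I_eq_I_iff_mem_unitaryGroup` this is exactly the stabiliser `Stab_{U(J)}(i1)` of the base point of the Hermitian tube. [Shimura1997, §6.5] -/
def siegelStabSubgroup : Subgroup (Matrix.unitaryGroup (l ⊕ l) ℂ) where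
  carrier := {U | ((U : Matrix (l ⊕ l) (l ⊕ l) ℂ))ᴴ * Matrix.J l ℂ * (U : Matrix (l ⊕ l) (l ⊕ l) ℂ) = Matrix.J l ℂ}
  mul_mem' := by
    intro U V hU hV
    simp only [Set.mem_setOf_eq, Matrix.UnitaryGroup.mul_val] at hU hV ⊢
    exact mul_mem_UJ hU hV
  one_mem' := by
    simp only [Set.mem_setOf_eq, Matrix.UnitaryGroup.one_val, conjTranspose_one, Matrix.one_mul, Matrix.mul_one]
  inv_mem' := by
    intro U hU
    simp only [Set.mem_setOf_eq, Matrix.UnitaryGroup.inv_val, star_eq_conjTranspose, conjTranspose_conjTranspose] at hU ⊢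
    have h1 : (U : Matrix (l ⊕ l) (l ⊕ l) ℂ) * (U : Matrix (l ⊕ l) (l ⊕ l) ℂ)ᴴ = 1 := by
      have h := Matrix.mem_unitaryGroup_iff.1 U.2
      rwa [star_eq_conjTranspose] at h
    calc (U : Matrix (l ⊕ l) (l ⊕ l) ℂ) * Matrix.J l ℂ * (U : Matrix (l ⊕ l) (l ⊕ l) ℂ)ᴴ
        = (U : Matrix (l ⊕ l) (l ⊕ l) ℂ) * ((U : Matrix (l ⊕ l) (l ⊕ l) ℂ)ᴴ * Matrix.J l ℂ * (U : Matrix (l ⊕ l) (l ⊕ l) ℂ)) *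
            (U : Matrix (l ⊕ l) (l ⊕ l) ℂ)ᴴ := by rw [hU]
      _ = ((U : Matrix (l ⊕ l) (l ⊕ l) ℂ) * (U : Matrix (l ⊕ l) (l ⊕ l) ℂ)ᴴ) * Matrix.J l ℂ *
            ((U : Matrix (l ⊕ l) (l ⊕ l) ℂ) * (U : Matrix (l ⊕ l) (l ⊕ l) ℂ)ᴴ) := by simp only [Matrix.mul_assoc]
      _ = Matrix.J l ℂ := by rw [h1, Matrix.one_mul, Matrix.mul_one]

variable {l}

/-- Membership: `U ∈ siegelStabSubgroup l ↔ Uᴴ J U = J`. -/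
theorem mem_siegelStabSubgroup_iff (U : Matrix.unitaryGroup (l ⊕ l) ℂ) :
    U ∈ siegelStabSubgroup l ↔ ((U : Matrix (l ⊕ l) (l ⊕ l) ℂ))ᴴ * Matrix.J l ℂ * (U : Matrix (l ⊕ l) (l ⊕ l) ℂ) = Matrix.J l ℂ :=
  Iff.rfl

/-- **`K_w` is CLOSED** in the unitary group (preimage of `{J}` under the continuous `U ↦ Uᴴ J U`). -/
theorem isClosed_siegelStabSubgroup : IsClosed (siegelStabSubgroup l : Set (Matrix.unitaryGroup (l ⊕ l) ℂ)) := by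
  have hc : Continuous fun U : Matrix.unitaryGroup (l ⊕ l) ℂ =>
      ((U : Matrix (l ⊕ l) (l ⊕ l) ℂ))ᴴ * Matrix.J l ℂ * (U : Matrix (l ⊕ l) (l ⊕ l) ℂ) := by
    have hval : Continuous fun U : Matrix.unitaryGroup (l ⊕ l) ℂ => (U : Matrix (l ⊕ l) (l ⊕ l) ℂ) := continuous_subtype_val
    exact ((hval.matrix_conjTranspose).mul continuous_const).mul hval
  exact isClosed_eq hc continuous_const

/-- Elements of `K_w` FIX the base point `i1`. -/
theorem moeb_I_of_mem {U : Matrix.unitaryGroup (l ⊕ l) ℂ} (hU : U ∈ siegelStabSubgroup l) :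
    moeb (U : Matrix (l ⊕ l) (l ⊕ l) ℂ) (I • (1 : Matrix l l ℂ)) = I • 1 :=
  moeb_I_eq_I_of_mem_unitaryGroup hU U.2

/-- Every `u ∈ U(J)` fixing `i1` is (the coercion of) an element of `K_w`. -/
theorem exists_mem_coe_eq {u : Matrix (l ⊕ l) (l ⊕ l) ℂ} (hu : uᴴ * Matrix.J l ℂ * u = Matrix.J l ℂ)
    (hI : moeb u (I • (1 : Matrix l l ℂ)) = I • 1) :
    ∃ U : Matrix.unitaryGroup (l ⊕ l) ℂ, U ∈ siegelStabSubgroup l ∧ (U : Matrix (l ⊕ l) (l ⊕ l) ℂ) = u :=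
  ⟨⟨u, mem_unitaryGroup_of_stab hu hI⟩, hu, rfl⟩

/-- The stabiliser as a set of matrices is the image of `K_w`. -/
theorem coe_image_eq :
    (fun U : Matrix.unitaryGroup (l ⊕ l) ℂ => (U : Matrix (l ⊕ l) (l ⊕ l) ℂ)) '' (siegelStabSubgroup l : Set (Matrix.unitaryGroup (l ⊕ l) ℂ)) =
      {u | uᴴ * Matrix.J l ℂ * u = Matrix.J l ℂ ∧ moeb u (I • (1 : Matrix l l ℂ)) = I • 1} := by
  ext u
  constructor
  · rintro ⟨U, hU, rfl⟩
    exact ⟨hU, moeb_I_of_mem hU⟩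
  · rintro ⟨hu, hI⟩
    obtain ⟨U, hU, rfl⟩ := exists_mem_coe_eq hu hI
    exact ⟨U, hU, rfl⟩

/-- **THE TRANSPORT OF RIGHT-`K_w`-FINITENESS** to F2's binder: if the right translates `g ↦ f (g · k₀)` (`k₀ ∈ K_w`) of `f : Matrix → ℂ` span a
finite-dimensional space of functions on matrices, then the right translates of the restriction `k ↦ f k` span a finite-dimensional space of
functions on `K_w` (image under the restriction linear map). [folklore] -/
theorem finiteDimensional_span_rightTranslates_restrict (f : Matrix (l ⊕ l) (l ⊕ l) ℂ → ℂ)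
    (hfin : FiniteDimensional ℂ (Submodule.span ℂ (Set.range fun k₀ : siegelStabSubgroup l =>
      fun g : Matrix (l ⊕ l) (l ⊕ l) ℂ => f (g * ((k₀ : Matrix.unitaryGroup (l ⊕ l) ℂ) : Matrix (l ⊕ l) (l ⊕ l) ℂ))))) :
    FiniteDimensional ℂ (Submodule.span ℂ (Set.range fun k₀ : siegelStabSubgroup l => fun k : siegelStabSubgroup l =>
      f (((k * k₀ : siegelStabSubgroup l) : Matrix.unitaryGroup (l ⊕ l) ℂ) : Matrix (l ⊕ l) (l ⊕ l) ℂ))) := by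
  -- the restriction map
  let R : (Matrix (l ⊕ l) (l ⊕ l) ℂ → ℂ) →ₗ[ℂ] (siegelStabSubgroup l → ℂ) :=
    { toFun := fun φ k => φ (((k : siegelStabSubgroup l) : Matrix.unitaryGroup (l ⊕ l) ℂ) : Matrix (l ⊕ l) (l ⊕ l) ℂ)
      map_add' := fun _ _ => rfl
      map_smul' := fun _ _ => rfl }
  have hsub : Submodule.span ℂ (Set.range fun k₀ : siegelStabSubgroup l => fun k : siegelStabSubgroup l =>
      f (((k * k₀ : siegelStabSubgroup l) : Matrix.unitaryGroup (l ⊕ l) ℂ) : Matrix (l ⊕ l) (l ⊕ l) ℂ)) ≤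
      Submodule.map R (Submodule.span ℂ (Set.range fun k₀ : siegelStabSubgroup l =>
        fun g : Matrix (l ⊕ l) (l ⊕ l) ℂ => f (g * ((k₀ : Matrix.unitaryGroup (l ⊕ l) ℂ) : Matrix (l ⊕ l) (l ⊕ l) ℂ)))) := by
    rw [Submodule.span_le]
    rintro _ ⟨k₀, rfl⟩
    refine ⟨fun g => f (g * ((k₀ : Matrix.unitaryGroup (l ⊕ l) ℂ) : Matrix (l ⊕ l) (l ⊕ l) ℂ)), Submodule.subset_span ⟨k₀, rfl⟩, ?_⟩
    funext k
    rfl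
  haveI : FiniteDimensional ℂ (Submodule.map R (Submodule.span ℂ (Set.range fun k₀ : siegelStabSubgroup l =>
      fun g : Matrix (l ⊕ l) (l ⊕ l) ℂ => f (g * ((k₀ : Matrix.unitaryGroup (l ⊕ l) ℂ) : Matrix (l ⊕ l) (l ⊕ l) ℂ))))) :=
    Module.Finite.map _ _
  exact Submodule.finiteDimensional_of_le hsub

end Summit.HodgeConjecture.HodgeConjecture.Cruxes.HLiu418.K2LiuSiegelStabSubgroup

end
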